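import Summits.Ventures.PercRepro.S2CountsCell
import Summits.Ventures.PercRepro.S2CoreFifteen

/-!
# PercRepro — S2: THE CELL INEQUALITY WITHOUT THE `1024`-QUANTISATION, AND THE KEY FORM AT EVERY `p` (p7, gen 19; sub-claim S2; the row `p = 13`)

Two wrappers for the cells `(p, d)` at level `5` with rational count parameters: **`c025_core_five_cell_direct`** —
`Φ·U + A + S ≤ 2^{p+d}` (from `2^n ≤ #Y + #{r ≤ 5} + #spanning`, `Matroid.two_pow_le_midCount_add`) — and
**`c025_core_five_cell_key`** — `Φ·U + A ≤ Σ_{s=6}^{p−1} C(p+d, s)` (from **`choose_sum_six_le_midCount_add`**: every set of `6 … p − 1`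
points has rank `< p`, so it is in `Y` unless its rank is `≤ 5` — the `p = 15` lemma `choose_sum_six_fourteen_le_midCount_add` at every
`p ≥ 6`). The quantised wrapper `c025_core_five_cell_of_counts_xqictq5g` loses up to `2^n/1024` on the tail side; at corank `≥ 30`
(`(A + S)/2^n → 1`) that loss is the whole margin, hence the direct forms. Nothing about any cell is claimed. Axioms: standard.
-/

open scoped Matroid

namespace PercRepro

namespace ThmN

open Set

variable {α : Type}

/-- **`Σ_{s=6}^{p−1} C(n, s) ≤ #Y(p, 5) + #{r ≤ 5}`** at every `p`: an `s`-subset with `6 ≤ s ≤ p − 1` has rank `< p`; it is in `Y`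
unless its rank is `≤ 5`. -/
theorem choose_sum_six_le_midCount_add (M : Matroid α) [M.Finite] (p : ℕ) :
    ∑ s ∈ Finset.Icc 6 (p - 1), M.ground_finite.toFinset.card.choose s ≤
      Matroid.midCount M p 5 + {X : Set α | X ⊆ M.E ∧ M.eRk X ≤ 5}.ncard := by
  have hE : (M.ground_finite.toFinset : Set α) = M.E := Set.Finite.coe_toFinset _
  rw [← ncard_subsets_ncard_mem M.ground_finite.toFinset (Finset.Icc 6 (p - 1))]
  unfold Matroid.midCount
  refine le_trans (Set.ncard_le_ncard ?_ ?_) (Set.ncard_union_le _ _)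
  · intro X hX
    have hXE : X ⊆ M.E := by rw [← hE]; exact hX.1
    have hXfin : X.Finite := M.ground_finite.subset hXE
    have hXc := Finset.mem_Icc.1 hX.2
    by_cases h5 : M.eRk X ≤ 5
    · exact Or.inr ⟨hXE, h5⟩
    · refine Or.inl ⟨hXE, lt_of_not_ge h5, ?_⟩
      calc M.eRk X ≤ X.encard := M.eRk_le_encard X
        _ = (X.ncard : ℕ∞) := by rw [← hXfin.cast_ncard_eq]
        _ < ((p : ℕ) : ℕ∞) := by exact_mod_cast (show X.ncard < p by omega)
  · exact (M.ground_finite.finite_subsets.subset (fun X hX => hX.1)).union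
      (M.ground_finite.finite_subsets.subset (fun X hX => hX.1))

/-- **The direct cell inequality**: `Φ·U + A + S ≤ 2^{p+d}` with `U`, `A`, `S` bounds on the top count, the rank-`≤ 5` count and the
spanning count gives `Φ·#U ≤ #Y` (no `1024`-quantisation). -/
theorem c025_core_five_cell_direct (M : Matroid α) [M.Finite] (p d : ℕ)
    (hR : M.eRank = (p : ℕ∞)) (hn : M.E.ncard = p + d)
    (U : ℚ) (hU : (Matroid.topCount M p 5 : ℚ) ≤ U)
    (A : ℚ) (hA : ({X : Set α | X ⊆ M.E ∧ M.eRk X ≤ 5}.ncard : ℚ) ≤ A)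
    (S : ℚ) (hS : ({X : Set α | X ⊆ M.E ∧ M.eRk X = M.eRank}.ncard : ℚ) ≤ S)
    (Φ : ℚ) (hΦ : 0 ≤ Φ) (hcell : Φ * U + A + S ≤ (2 : ℚ) ^ (p + d)) :
    Φ * (Matroid.topCount M p 5 : ℚ) ≤ (Matroid.midCount M p 5 : ℚ) := by
  have hEcard : M.ground_finite.toFinset.card = p + d := by
    rw [← Set.ncard_eq_toFinset_card _ M.ground_finite]; exact hn
  have hY := Matroid.two_pow_le_midCount_add (M := M) p 5 hR
  rw [hEcard] at hY
  have hYq : (2 : ℚ) ^ (p + d) ≤ (Matroid.midCount M p 5 : ℚ) +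
      ({X : Set α | X ⊆ M.E ∧ M.eRk X ≤ 5}.ncard : ℚ) +
      ({X : Set α | X ⊆ M.E ∧ M.eRk X = M.eRank}.ncard : ℚ) := by exact_mod_cast hY
  have h1 : Φ * (Matroid.topCount M p 5 : ℚ) ≤ Φ * U := mul_le_mul_of_nonneg_left hU hΦ
  linarith

/-- **The key cell inequality**: `Φ·U + A ≤ Σ_{s=6}^{p−1} C(p+d, s)` gives `Φ·#U ≤ #Y` (no spanning count, no tail quantisation). -/
theorem c025_core_five_cell_key (M : Matroid α) [M.Finite] (p d : ℕ) (hn : M.E.ncard = p + d)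
    (U : ℚ) (hU : (Matroid.topCount M p 5 : ℚ) ≤ U)
    (A : ℚ) (hA : ({X : Set α | X ⊆ M.E ∧ M.eRk X ≤ 5}.ncard : ℚ) ≤ A)
    (Φ : ℚ) (hΦ : 0 ≤ Φ) (hcell : Φ * U + A ≤ ((∑ s ∈ Finset.Icc 6 (p - 1), (p + d).choose s : ℕ) : ℚ)) :
    Φ * (Matroid.topCount M p 5 : ℚ) ≤ (Matroid.midCount M p 5 : ℚ) := by
  have hEcard : M.ground_finite.toFinset.card = p + d := by
    rw [← Set.ncard_eq_toFinset_card _ M.ground_finite]; exact hn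
  have hY := choose_sum_six_le_midCount_add M p
  rw [hEcard] at hY
  have hYq : ((∑ s ∈ Finset.Icc 6 (p - 1), (p + d).choose s : ℕ) : ℚ) ≤ (Matroid.midCount M p 5 : ℚ) +
      ({X : Set α | X ⊆ M.E ∧ M.eRk X ≤ 5}.ncard : ℚ) := by exact_mod_cast hY
  have h1 : Φ * (Matroid.topCount M p 5 : ℚ) ≤ Φ * U := mul_le_mul_of_nonneg_left hU hΦ
  linarith

end ThmN

end PercRepro
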